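import Summits.RiemannHypothesis.RiemannHypothesis.Theorems.OddOneSignedWindows.Negative.OddFoldPointwise
import HarnessLib

/-!
# `OddOneSignedWindows` (stmt-RiemannHypothesis-17778), negative lemmas II: increments and pole form of the test pair

Part 2 of 3 (main file `OddFoldRaisesEnergy.lean`, same directory). For the antidiagonal pair
`G = r₁ − r₂`, `H = r₁ + r₂` of Part 1 (`OddFoldPointwise.lean`), in the normalisation of
`Literature/NumberTheory/LFunctions/WeilMarkovQuadratic.lean` (`D_t = weilIncrement`,
`P = weilPoleForm`):

* `weilIncrement_sub_eq`: `D_t(H) − D_t(G) = 4 ∫ (r₁(x+t) − r₁(x))(r₂(x+t) − r₂(x)) dx`;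
* `weilIncrement_sub_nonneg`: `D_t(H) ≥ D_t(G)` for `t > 0` off the translation window;
* `neg_le_weilIncrement_sub`: `D_t(H) − D_t(G) ≥ −16η` for every `t > 0`;
* `le_weilIncrement_sub_log_two`: `D_{log 2}(H) − D_{log 2}(G) = 8 ∫ p² ≥ 8η` — the REFLECTION ATOM;
* `neg_le_weilPoleForm_sub`: `P(H) − P(G) = −8 s₁ s₂ ≥ −128 η²` (`sᵢ = ∫ rᵢ sinh(t/2) ∈ [0, 4η]`,
  the `cosh` moments vanish by oddness).

Everything inline (no `def`), all `[folklore]`.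
-/

noncomputable section

open Set MeasureTheory Filter Metric
open scoped Real Topology ComplexConjugate

namespace Summit.RiemannHypothesis.Cruxes.OddOneSignedWindows.Negative

open Literature.NumberTheory.LFunctions

/-! ## 1. Two integration tools -/

/-- A continuous real function vanishing off a bounded interval is integrable. [folklore] -/
theorem integrable_of_support_Ioo {f : ℝ → ℝ} (hf : Continuous f) {l u : ℝ}
    (h : ∀ x, f x ≠ 0 → l < x ∧ x < u) : Integrable f :=
  hf.integrable_of_hasCompactSupport (HasCompactSupport.intro (K := Icc l u) isCompact_Icc
    fun x hx ↦ by
      by_contra hne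
      exact hx ⟨(h x hne).1.le, (h x hne).2.le⟩)

/-- For an odd `F` the `cosh` moment vanishes: `∫ F(x) cosh(x/2) dx = 0` (no integrability
needed: the substitution `x ↦ −x` is unconditional). [folklore] -/
theorem integral_mul_cosh_eq_zero_of_odd {F : ℝ → ℂ} (hF : ∀ x, F (-x) = -F x) :
    ∫ x, F x * (Real.cosh (x / 2) : ℂ) = 0 := by
  have h := integral_neg_eq_self (fun x ↦ F x * (Real.cosh (x / 2) : ℂ)) volume
  simp only [hF, neg_div, Real.cosh_neg, neg_mul, integral_neg] at h
  -- `h : -I = I`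
  have h2 : (2 : ℂ) * ∫ x, F x * (Real.cosh (x / 2) : ℂ) = 0 := by
    rw [two_mul]
    nth_rewrite 1 [← h]
    ring
  exact (mul_eq_zero.1 h2).resolve_left two_ne_zero


/-! ## 2. Increments and pole form of the pair -/

section PairIntegrals

variable {p r₁ r₂ : ℝ → ℝ} {G H : ℝ → ℂ} {τ₀ η : ℝ}

/-- **Difference of increments.** `D_t(H) − D_t(G) = 4 ∫ (r₁(x+t) − r₁(x))(r₂(x+t) − r₂(x)) dx`
for `G = r₁ − r₂`, `H = r₁ + r₂` real-valued test functions. [folklore] -/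
theorem weilIncrement_sub_eq (hG : IsWeilTest G) (hH : IsWeilTest H)
    (hGr : ∀ x, G x = ((r₁ x - r₂ x : ℝ) : ℂ)) (hHr : ∀ x, H x = ((r₁ x + r₂ x : ℝ) : ℂ)) (t : ℝ) :
    weilIncrement H t - weilIncrement G t =
      4 * ∫ x, (r₁ (x + t) - r₁ x) * (r₂ (x + t) - r₂ x) := by
  have hHi := integrable_weilIncrement_integrand hH.memLp_two t
  have hGi := integrable_weilIncrement_integrand hG.memLp_two t
  unfold weilIncrement
  rw [← integral_sub hHi hGi, ← integral_const_mul]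
  refine integral_congr_ae (Eventually.of_forall fun x ↦ ?_)
  have e : ∀ u : ℝ, ‖((u : ℝ) : ℂ)‖ ^ 2 = u ^ 2 := fun u ↦ by
    rw [Complex.norm_real, Real.norm_eq_abs, sq_abs]
  simp only [hGr, hHr, ← Complex.ofReal_sub, e]
  ring

/-- The integrand `(r₁(x+t) − r₁(x))(r₂(x+t) − r₂(x))` is integrable (it is a quarter of the
difference of the two integrable increment integrands). [folklore] -/
theorem integrable_incr_mul_incr (hG : IsWeilTest G) (hH : IsWeilTest H)
    (hGr : ∀ x, G x = ((r₁ x - r₂ x : ℝ) : ℂ)) (hHr : ∀ x, H x = ((r₁ x + r₂ x : ℝ) : ℂ)) (t : ℝ) :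
    Integrable fun x ↦ (r₁ (x + t) - r₁ x) * (r₂ (x + t) - r₂ x) := by
  have hHi := integrable_weilIncrement_integrand hH.memLp_two t
  have hGi := integrable_weilIncrement_integrand hG.memLp_two t
  refine ((hHi.sub hGi).div_const 4).congr (Eventually.of_forall fun x ↦ ?_)
  have e : ∀ u : ℝ, ‖((u : ℝ) : ℂ)‖ ^ 2 = u ^ 2 := fun u ↦ by
    rw [Complex.norm_real, Real.norm_eq_abs, sq_abs]
  simp only [Pi.sub_apply, hGr, hHr, ← Complex.ofReal_sub, e]
  ring

variable (hη : 0 < η) (hτ : η < τ₀) (hsep : τ₀ + η < Real.log 2 - τ₀ - η)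
  (hpc : Continuous p) (hp0 : ∀ y, 0 ≤ p y) (hp1 : ∀ y, p y ≤ 1)
  (hps : ∀ y, p y ≠ 0 → τ₀ - η < y ∧ y < τ₀ + η) (hpI : ∫ y, p y ≤ 2 * η)
  (hpI2 : η ≤ ∫ y, p y * p y)
  (hr₁ : ∀ y, r₁ y = p y - p (-y)) (hr₂ : ∀ y, r₂ y = p (Real.log 2 - y) - p (Real.log 2 - -y))
  (hG : IsWeilTest G) (hH : IsWeilTest H)
  (hGr : ∀ x, G x = ((r₁ x - r₂ x : ℝ) : ℂ)) (hHr : ∀ x, H x = ((r₁ x + r₂ x : ℝ) : ℂ))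

include hη hτ hsep hp0 hps hr₁ hr₂ hG hH hGr hHr in
/-- Off the translation window (and for `t > 0`) folding does not lower the increment:
`D_t(H) ≥ D_t(G)`. [folklore] -/
theorem weilIncrement_sub_nonneg {t : ℝ} (ht : 0 < t)
    (htI : t ∉ Ioo (Real.log 2 - 2 * τ₀ - 2 * η) (Real.log 2 - 2 * τ₀ + 2 * η)) :
    0 ≤ weilIncrement H t - weilIncrement G t := by
  rw [weilIncrement_sub_eq hG hH hGr hHr t]
  refine mul_nonneg (by norm_num) (integral_nonneg fun x ↦ ?_)
  have := incr_mul_incr_nonneg_of_notMem hη hτ hsep hp0 hps ht htI x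
  simpa only [hr₁, hr₂, Pi.zero_apply] using this

include hη hτ hsep hpc hp0 hp1 hps hpI hr₁ hr₂ hG hH hGr hHr in
/-- For every `t > 0`: `D_t(H) − D_t(G) ≥ −16η` (the two translation terms integrate to
`2 ∫ p ≤ 4η` each, times `4`). [folklore] -/
theorem neg_le_weilIncrement_sub {t : ℝ} (ht : 0 < t) :
    -(16 * η) ≤ weilIncrement H t - weilIncrement G t := by
  rw [weilIncrement_sub_eq hG hH hGr hHr t]
  -- integrability of the translated bump
  have hi1 : Integrable fun x ↦ p (-(x + t)) :=
    integrable_of_support_Ioo (hpc.comp (continuous_neg.comp (continuous_id.add continuous_const)))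
      (l := -(τ₀ + η) - t) (u := -(τ₀ - η) - t) fun x hx ↦ by
        have b := hps _ hx
        constructor <;> linarith [b.1, b.2]
  have hi2 : Integrable p := integrable_of_support_Ioo hpc hps
  have hlow : ∫ x, -(p (-(x + t)) + p x) ≤ ∫ x, (r₁ (x + t) - r₁ x) * (r₂ (x + t) - r₂ x) := by
    refine integral_mono (hi1.add hi2).neg (integrable_incr_mul_incr hG hH hGr hHr t) fun x ↦ ?_
    have := neg_le_incr_mul_incr hη hτ hsep hp0 hp1 hps ht x
    simpa only [hr₁, hr₂] using this
  have hval : ∫ x, -(p (-(x + t)) + p x) = -(2 * ∫ x, p x) := by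
    rw [integral_neg, integral_add hi1 hi2]
    have h1 : ∫ x, p (-(x + t)) = ∫ x, p x := by
      have := integral_add_right_eq_self (μ := volume) (fun y ↦ p (-y)) t
      rw [this]
      exact integral_neg_eq_self (fun y ↦ p y) volume
    rw [h1]
    ring
  rw [hval] at hlow
  linarith

include hη hτ hsep hpc hps hpI2 hr₁ hr₂ hG hH hGr hHr in
/-- At the reflection length: `D_{log 2}(H) − D_{log 2}(G) = 8 ∫ p² ≥ 8η`. [folklore] -/
theorem le_weilIncrement_sub_log_two :
    8 * η ≤ weilIncrement H (Real.log 2) - weilIncrement G (Real.log 2) := by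
  rw [weilIncrement_sub_eq hG hH hGr hHr (Real.log 2)]
  have hi1 : Integrable fun x ↦ p (x + Real.log 2) * p (x + Real.log 2) :=
    integrable_of_support_Ioo ((hpc.comp (continuous_id.add continuous_const)).mul
      (hpc.comp (continuous_id.add continuous_const)))
      (l := τ₀ - η - Real.log 2) (u := τ₀ + η - Real.log 2) fun x hx ↦ by
        have b := hps _ (left_ne_zero_of_mul hx)
        constructor <;> linarith [b.1, b.2]
  have hi2 : Integrable fun x ↦ p (-x) * p (-x) :=
    integrable_of_support_Ioo ((hpc.comp continuous_neg).mul (hpc.comp continuous_neg))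
      (l := -(τ₀ + η)) (u := -(τ₀ - η)) fun x hx ↦ by
        have b := hps _ (left_ne_zero_of_mul hx)
        constructor <;> linarith [b.1, b.2]
  have hval : ∫ x, (r₁ (x + Real.log 2) - r₁ x) * (r₂ (x + Real.log 2) - r₂ x) =
      2 * ∫ x, p x * p x := by
    have e : ∀ x, (r₁ (x + Real.log 2) - r₁ x) * (r₂ (x + Real.log 2) - r₂ x) =
        p (x + Real.log 2) * p (x + Real.log 2) + p (-x) * p (-x) := fun x ↦ by
      have := incr_mul_incr_log_two hη hτ hsep hps x
      simpa only [hr₁, hr₂] using this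
    simp_rw [e]
    rw [integral_add hi1 hi2]
    have h1 : ∫ x, p (x + Real.log 2) * p (x + Real.log 2) = ∫ x, p x * p x :=
      integral_add_right_eq_self (μ := volume) (fun y ↦ p y * p y) (Real.log 2)
    have h2 : ∫ x, p (-x) * p (-x) = ∫ x, p x * p x :=
      integral_neg_eq_self (fun y ↦ p y * p y) volume
    rw [h1, h2]
    ring
  rw [hval]
  linarith

include hη hτ hpc hps hr₁ in
/-- `x ↦ r₁(x) sinh(x/2)` is integrable. [folklore] -/
theorem integrable_r₁_mul_sinh : Integrable fun x ↦ r₁ x * Real.sinh (x / 2) := by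
  have e : (fun x ↦ r₁ x * Real.sinh (x / 2)) = fun x ↦ (p x - p (-x)) * Real.sinh (x / 2) := by
    funext x; rw [hr₁]
  rw [e]
  exact integrable_of_support_Ioo ((hpc.sub (hpc.comp continuous_neg)).mul
    (Real.continuous_sinh.comp (continuous_id.div_const _)))
    (l := -(τ₀ + η)) (u := τ₀ + η) fun x hx ↦ by
      have hne := left_ne_zero_of_mul hx
      by_cases h1 : p x = 0
      · rw [h1, zero_sub, neg_ne_zero] at hne
        have b := hps _ hne
        constructor <;> linarith [b.1, b.2]
      · have b := hps _ h1
        constructor <;> linarith [b.1, b.2]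

include hη hτ hsep hpc hps hr₂ in
/-- `x ↦ r₂(x) sinh(x/2)` is integrable. [folklore] -/
theorem integrable_r₂_mul_sinh : Integrable fun x ↦ r₂ x * Real.sinh (x / 2) := by
  have hqs : ∀ y, p (Real.log 2 - y) ≠ 0 →
      Real.log 2 - τ₀ - η < y ∧ y < Real.log 2 - τ₀ + η := fun y hy ↦ by
    have b := hps _ hy
    constructor <;> linarith [b.1, b.2]
  have e : (fun x ↦ r₂ x * Real.sinh (x / 2)) =
      fun x ↦ (p (Real.log 2 - x) - p (Real.log 2 - -x)) * Real.sinh (x / 2) := by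
    funext x; rw [hr₂]
  rw [e]
  exact integrable_of_support_Ioo (((hpc.comp (continuous_const.sub continuous_id)).sub
    (hpc.comp (continuous_const.sub continuous_neg))).mul
    (Real.continuous_sinh.comp (continuous_id.div_const _)))
    (l := -(Real.log 2 - τ₀ + η)) (u := Real.log 2 - τ₀ + η) fun x hx ↦ by
      have hne := left_ne_zero_of_mul hx
      by_cases h1 : p (Real.log 2 - x) = 0
      · rw [h1, zero_sub, neg_ne_zero] at hne
        have b := hqs (-x) hne
        constructor <;> linarith [b.1, b.2]
      · have b := hqs x h1
        constructor <;> linarith [b.1, b.2]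

include hη hτ hsep hpc hp0 hps hpI hr₁ in
/-- The `sinh` moment of `r₁`: `0 ≤ ∫ r₁(x) sinh(x/2) dx ≤ 4η`. [folklore] -/
theorem sinh_moment_r₁ :
    0 ≤ ∫ x, r₁ x * Real.sinh (x / 2) ∧ ∫ x, r₁ x * Real.sinh (x / 2) ≤ 4 * η := by
  have hlog2 : Real.log 2 < 1 := by have := Real.log_two_lt_d9; linarith
  have hi2 : Integrable p := integrable_of_support_Ioo hpc hps
  have hi3 : Integrable fun x ↦ p (-x) :=
    integrable_of_support_Ioo (hpc.comp continuous_neg) (l := -(τ₀ + η)) (u := -(τ₀ - η))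
      fun x hx ↦ by
        have b := hps _ hx
        constructor <;> linarith [b.1, b.2]
  have hpt0 : ∀ x, 0 ≤ r₁ x * Real.sinh (x / 2) := by
    intro x
    rw [hr₁]
    rcases le_or_gt 0 x with hx | hx
    · have : p (-x) = 0 := by
        by_contra h
        have b := hps _ h
        linarith [b.1]
      rw [this, sub_zero]
      exact mul_nonneg (hp0 _) (Real.sinh_nonneg_iff.2 (by linarith))
    · have : p x = 0 := by
        by_contra h
        have b := hps _ h
        linarith [b.1]
      rw [this, zero_sub, neg_mul, neg_nonneg]
      exact mul_nonpos_of_nonneg_of_nonpos (hp0 _) (Real.sinh_nonpos_iff.2 (by linarith))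
  have hpt1 : ∀ x, r₁ x * Real.sinh (x / 2) ≤ p x + p (-x) := by
    intro x
    rw [hr₁]
    rcases le_or_gt 0 x with hx | hx
    · have h0 : p (-x) = 0 := by
        by_contra h
        have b := hps _ h
        linarith [b.1]
      rw [h0, sub_zero, add_zero]
      by_cases hpx : p x = 0
      · rw [hpx, zero_mul]
      · have b := hps _ hpx
        have hs : Real.sinh (x / 2) ≤ 1 := sinh_le_one (by linarith [b.2])
        exact (mul_le_mul_of_nonneg_left hs (hp0 _)).trans_eq (mul_one _)
    · have h0 : p x = 0 := by
        by_contra h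
        have b := hps _ h
        linarith [b.1]
      rw [h0, zero_sub, zero_add, neg_mul]
      by_cases hpx : p (-x) = 0
      · rw [hpx, zero_mul, neg_zero]
      · have b := hps _ hpx
        have hs : Real.sinh (-(x / 2)) ≤ 1 := sinh_le_one (by linarith [b.2])
        rw [Real.sinh_neg] at hs
        have := mul_le_mul_of_nonneg_left hs (hp0 (-x))
        linarith
  refine ⟨integral_nonneg hpt0, ?_⟩
  have hiR := integrable_r₁_mul_sinh hη hτ hpc hps hr₁
  calc ∫ x, r₁ x * Real.sinh (x / 2) ≤ ∫ x, (p x + p (-x)) := integral_mono hiR (hi2.add hi3) hpt1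
    _ = 2 * ∫ x, p x := by
        rw [integral_add hi2 hi3, integral_neg_eq_self (fun y ↦ p y) volume]
        ring
    _ ≤ 4 * η := by linarith

include hη hτ hsep hpc hp0 hps hpI hr₂ in
/-- The `sinh` moment of `r₂`: `0 ≤ ∫ r₂(x) sinh(x/2) dx ≤ 4η`. [folklore] -/
theorem sinh_moment_r₂ :
    0 ≤ ∫ x, r₂ x * Real.sinh (x / 2) ∧ ∫ x, r₂ x * Real.sinh (x / 2) ≤ 4 * η := by
  have hlog2 : Real.log 2 < 1 := by have := Real.log_two_lt_d9; linarith
  -- `q = p(log 2 − ·)` lives on `(σ₀ − η, σ₀ + η) ⊂ (0, 1)`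
  have hqs : ∀ y, p (Real.log 2 - y) ≠ 0 →
      Real.log 2 - τ₀ - η < y ∧ y < Real.log 2 - τ₀ + η := fun y hy ↦ by
    have b := hps _ hy
    constructor <;> linarith [b.1, b.2]
  have hi2 : Integrable fun x ↦ p (Real.log 2 - x) :=
    integrable_of_support_Ioo (hpc.comp (continuous_const.sub continuous_id)) hqs
  have hi3 : Integrable fun x ↦ p (Real.log 2 - -x) :=
    integrable_of_support_Ioo (hpc.comp (continuous_const.sub continuous_neg))
      (l := -(Real.log 2 - τ₀ + η)) (u := -(Real.log 2 - τ₀ - η)) fun x hx ↦ by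
        have b := hqs (-x) hx
        constructor <;> linarith [b.1, b.2]
  have hpt0 : ∀ x, 0 ≤ r₂ x * Real.sinh (x / 2) := by
    intro x
    rw [hr₂]
    rcases le_or_gt 0 x with hx | hx
    · have : p (Real.log 2 - -x) = 0 := by
        by_contra h
        have b := hqs (-x) h
        linarith [b.1]
      rw [this, sub_zero]
      exact mul_nonneg (hp0 _) (Real.sinh_nonneg_iff.2 (by linarith))
    · have : p (Real.log 2 - x) = 0 := by
        by_contra h
        have b := hqs x h
        linarith [b.1]
      rw [this, zero_sub, neg_mul, neg_nonneg]
      exact mul_nonpos_of_nonneg_of_nonpos (hp0 _) (Real.sinh_nonpos_iff.2 (by linarith))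
  have hpt1 : ∀ x, r₂ x * Real.sinh (x / 2) ≤ p (Real.log 2 - x) + p (Real.log 2 - -x) := by
    intro x
    rw [hr₂]
    rcases le_or_gt 0 x with hx | hx
    · have h0 : p (Real.log 2 - -x) = 0 := by
        by_contra h
        have b := hqs (-x) h
        linarith [b.1]
      rw [h0, sub_zero, add_zero]
      by_cases hpx : p (Real.log 2 - x) = 0
      · rw [hpx, zero_mul]
      · have b := hqs x hpx
        have hs : Real.sinh (x / 2) ≤ 1 := sinh_le_one (by linarith [b.2])
        exact (mul_le_mul_of_nonneg_left hs (hp0 _)).trans_eq (mul_one _)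
    · have h0 : p (Real.log 2 - x) = 0 := by
        by_contra h
        have b := hqs x h
        linarith [b.1]
      rw [h0, zero_sub, zero_add, neg_mul]
      by_cases hpx : p (Real.log 2 - -x) = 0
      · rw [hpx, zero_mul, neg_zero]
      · have b := hqs (-x) hpx
        have hs : Real.sinh (-(x / 2)) ≤ 1 := sinh_le_one (by linarith [b.2])
        rw [Real.sinh_neg] at hs
        have := mul_le_mul_of_nonneg_left hs (hp0 (Real.log 2 - -x))
        linarith
  refine ⟨integral_nonneg hpt0, ?_⟩
  have hiR := integrable_r₂_mul_sinh hη hτ hsep hpc hps hr₂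
  calc ∫ x, r₂ x * Real.sinh (x / 2) ≤ ∫ x, (p (Real.log 2 - x) + p (Real.log 2 - -x)) :=
        integral_mono hiR (hi2.add hi3) hpt1
    _ = 2 * ∫ x, p x := by
        rw [integral_add hi2 hi3]
        have h1 : ∫ x, p (Real.log 2 - x) = ∫ x, p x :=
          integral_sub_left_eq_self (fun y ↦ p y) volume (Real.log 2)
        have h2 : ∫ x, p (Real.log 2 - -x) = ∫ x, p x := by
          have := integral_add_left_eq_self (μ := volume) (fun y ↦ p y) (Real.log 2)
          simp only [sub_neg_eq_add]
          exact this
        rw [h1, h2]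
        ring
    _ ≤ 4 * η := by linarith

include hη hτ hsep hpc hp0 hps hpI hr₁ hr₂ hGr hHr in
/-- **The pole form barely moves**: `P(H) − P(G) = −8 s₁ s₂ ≥ −128 η²` (`sᵢ` the `sinh`
moments, the `cosh` moments vanish by oddness). [folklore] -/
theorem neg_le_weilPoleForm_sub :
    -(128 * η ^ 2) ≤ weilPoleForm H - weilPoleForm G := by
  have hHo : ∀ x, H (-x) = -H x := fun x ↦ by
    rw [hHr, hHr, hr₁, hr₁, hr₂, hr₂, neg_neg]; push_cast; ring
  have hGo : ∀ x, G (-x) = -G x := fun x ↦ by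
    rw [hGr, hGr, hr₁, hr₁, hr₂, hr₂, neg_neg]; push_cast; ring
  obtain ⟨h10, h11⟩ := sinh_moment_r₁ hη hτ hsep hpc hp0 hps hpI hr₁
  obtain ⟨h20, h21⟩ := sinh_moment_r₂ hη hτ hsep hpc hp0 hps hpI hr₂
  have hi1 := integrable_r₁_mul_sinh hη hτ hpc hps hr₁
  have hi2 := integrable_r₂_mul_sinh hη hτ hsep hpc hps hr₂
  set s₁ : ℝ := ∫ x, r₁ x * Real.sinh (x / 2) with hs₁
  set s₂ : ℝ := ∫ x, r₂ x * Real.sinh (x / 2) with hs₂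
  -- the complex `sinh` moments
  have hsinhH : ∫ x, H x * (Real.sinh (x / 2) : ℂ) = ((s₁ + s₂ : ℝ) : ℂ) := by
    have e : (fun x ↦ H x * (Real.sinh (x / 2) : ℂ)) =
        fun x ↦ (((r₁ x * Real.sinh (x / 2) + r₂ x * Real.sinh (x / 2) : ℝ)) : ℂ) := by
      funext x; rw [hHr]; push_cast; ring
    rw [e, integral_complex_ofReal, integral_add hi1 hi2]
  have hsinhG : ∫ x, G x * (Real.sinh (x / 2) : ℂ) = ((s₁ - s₂ : ℝ) : ℂ) := by
    have e : (fun x ↦ G x * (Real.sinh (x / 2) : ℂ)) =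
        fun x ↦ (((r₁ x * Real.sinh (x / 2) - r₂ x * Real.sinh (x / 2) : ℝ)) : ℂ) := by
      funext x; rw [hGr]; push_cast; ring
    rw [e, integral_complex_ofReal, integral_sub hi1 hi2]
  have hPH : weilPoleForm H = -2 * (s₁ + s₂) ^ 2 := by
    rw [weilPoleForm, integral_mul_cosh_eq_zero_of_odd hHo, hsinhH, norm_zero, Complex.norm_real,
      Real.norm_eq_abs, sq_abs]
    ring
  have hPG : weilPoleForm G = -2 * (s₁ - s₂) ^ 2 := by
    rw [weilPoleForm, integral_mul_cosh_eq_zero_of_odd hGo, hsinhG, norm_zero, Complex.norm_real,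
      Real.norm_eq_abs, sq_abs]
    ring
  rw [hPH, hPG]
  have hprod : s₁ * s₂ ≤ 4 * η * (4 * η) := mul_le_mul h11 h21 h20 (by linarith)
  nlinarith

end PairIntegrals

end Summit.RiemannHypothesis.Cruxes.OddOneSignedWindows.Negative

end
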